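import Summits.CriticalPhenomena.PercolationContinuityZ3.Theorems.PercNearOneGluingNoHeavyLowerTailSahiCTCC2TopSlice
import Summits.CriticalPhenomena.PercolationContinuityZ3.Theorems.PercNearOneGluingNoHeavyLowerTailSahiCTCRtBigNested
import HarnessLib

/-!
# `NoHeavyLowerTail` (crux stmt-CriticalPhenomena-4575), P3 lane: THE LOOP PEEL FOR `R_3` ITSELF —
# at a vertex `s` with `{s} ∈ 𝒳` (a loop of one family), `coeff_{n+2e_s} R_3 + coeff_n R_3 ≤ coeff_{n+e_s} R_3` for every `s`-free profile `n`

Support file (seat `prim-l12-p3`, gen 44; `--supports stmt-CriticalPhenomena-4575`).  Memo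
`run/shared/lean/prim/prim-l12/FROM-prim-l12-p3-g44-R3-PEELS.md` §2.

Gen 43 proved the loop peel for the C2 *difference* of `R_3` (`…SahiCTCC2ThreeLoopPeel`).  The same phenomenon holds one level down, for the
coefficients of `R_3(𝒳,𝒵) = Θ₂·(Π·Y_{≥3} − X·Z) + Π·X_{≤2}·Z_{≤2}` themselves, with a two-line proof:
* `coeff_Rt_three_add_single_three_eq_zero_of_loop` : if `{s} ∈ 𝒳` then `coeff_{n+3e_s} R_3(𝒳,𝒵) = 0` for `s`-free `n` — the top slice at `s`
  is `R_2` of the section cylinders (`…SahiCTCC2TopSlice.coeff_Rt_succ_add_single_three`), the cylinder of `𝒳` at a loop is the whole power set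
  (`cyl_eq_powerset_of_loop`), and `R_t(2^V, 𝒵) = 0` identically (`Rt_powerset_left`);
* the vertex identity `[c(n+e_s) − c(n)] − [c(n+2e_s) − c(n+3e_s)] = coeff_n((D⁰−D¹)(X¹−X⁰)(Z¹−Z⁰)) ≥ 0` of `…SahiCTCLumpedVertex`
  (`coeff_C1_sub_C2_eq` / `_nonneg`, `D = {#S < 3}` a down-set);
hence **`coeff_Rt_three_loopPeel`**: `coeff_{n+2e_s} R_3 + coeff_n R_3 ≤ coeff_{n+e_s} R_3` (and `'` for a loop of `𝒵`, by `Rt_comm`).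
Reading: a single point of the profile that is a loop of either family can be DOUBLED at the cost of the same pair at the profile with the point
removed ("row `q` → row `q+1` plus induction on the number of single points"), now for `R_3` directly rather than for its C2 slice.  This is the first of
the three peels of the memo (loop / adjacent / isolated) that organise the remaining low rows of `R_3 ∈ ℕ[s]`.  Nothing is asserted about the crux.
-/

noncomputable section

open scoped Classical

namespace Summit.CriticalPhenomena.PercolationContinuityZ3.Theorems.SahiCTCForms

open Finset MvPolynomial SahiCTCGenFun

variable {α : Type*} [DecidableEq α] [Fintype α]

/-! ### A loop makes the cylinder trivial, and `R_t` vanishes on a trivial family -/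

/-- At a loop `{s} ∈ 𝒳` of an up-set, the cylinder `{S : S + s ∈ 𝒳}` is the whole power set. [this work] -/
theorem cyl_eq_powerset_of_loop {F : Finset (Finset α)} (hF : IsUpperSet (F : Set (Finset α))) {s : α}
    (hs : ({s} : Finset α) ∈ F) : cyl s F = (univ.powerset : Finset (Finset α)) := by
  ext S
  rw [mem_cyl, powerset_univ]
  simp only [mem_univ, iff_true]
  exact hF (by simp) hs

omit [DecidableEq α] in
/-- The members of size `< t` of the whole power set are the sets of size `< t`. [this work] -/
theorem below_powerset_eq (t : ℕ) : below t (univ.powerset : Finset (Finset α)) = bySize (· < t) := by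
  ext S; simp [below, bySize]

/-- **`R_t(2^V, 𝒵) = 0`**: the `R` form vanishes identically when the first family is everything. [this work] -/
theorem Rt_powerset_left (t : ℕ) (G : Finset (Finset α)) : Rt t (univ.powerset : Finset (Finset α)) G = 0 := by
  unfold Rt
  have h1 : (univ.powerset : Finset (Finset α)) ∩ G = G := by
    ext S; simp
  rw [h1, below_powerset_eq, gf_eq_atLeast_add_below t G]
  unfold PiP
  ring

/-- **The top slice at a loop vanishes**: if `{s} ∈ 𝒳` then `coeff_{n+3e_s} R_3(𝒳,𝒵) = 0` for every `s`-free `n`. [this work] -/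
theorem coeff_Rt_three_add_single_three_eq_zero_of_loop {F G : Finset (Finset α)} (hF : IsUpperSet (F : Set (Finset α)))
    {s : α} (hs : ({s} : Finset α) ∈ F) {n : α →₀ ℕ} (hn : n s = 0) :
    (Rt 3 F G).coeff (n + Finsupp.single s 3) = 0 := by
  rw [coeff_Rt_succ_add_single_three 2 F G s hn, cyl_eq_powerset_of_loop hF hs, Rt_powerset_left, coeff_zero]

/-! ### The loop peel -/

/-- **LOOP PEEL FOR `R_3`.**  For up-sets `𝒳, 𝒵`, a vertex `s` with `{s} ∈ 𝒳` and an `s`-free profile `n`: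
`coeff_{n+2e_s} R_3(𝒳,𝒵) + coeff_n R_3(𝒳,𝒵) ≤ coeff_{n+e_s} R_3(𝒳,𝒵)` — a loop single point can be doubled at the cost of the profile with the
point removed. [this work] -/
theorem coeff_Rt_three_loopPeel {F G : Finset (Finset α)} (hF : IsUpperSet (F : Set (Finset α))) (hG : IsUpperSet (G : Set (Finset α)))
    {s : α} (hs : ({s} : Finset α) ∈ F) {n : α →₀ ℕ} (hn : n s = 0) :
    (Rt 3 F G).coeff (n + Finsupp.single s 2) + (Rt 3 F G).coeff n ≤ (Rt 3 F G).coeff (n + Finsupp.single s 1) := by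
  have h3 := coeff_Rt_three_add_single_three_eq_zero_of_loop (G := G) hF hs hn
  have hid := coeff_C1_sub_C2_eq (bySize (· < 3)) F G s hn
  have hnn := coeff_C1_sub_C2_nonneg (isLowerSet_bySize_lt 3) hF hG s hn
  rw [← Rt_eq_Rlump] at hid hnn
  rw [h3] at hid hnn
  linarith

/-- **LOOP PEEL FOR `R_3`**, loop of the second family: if `{s} ∈ 𝒵` then
`coeff_{n+2e_s} R_3(𝒳,𝒵) + coeff_n R_3(𝒳,𝒵) ≤ coeff_{n+e_s} R_3(𝒳,𝒵)` for `s`-free `n`. [this work] -/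
theorem coeff_Rt_three_loopPeel' {F G : Finset (Finset α)} (hF : IsUpperSet (F : Set (Finset α))) (hG : IsUpperSet (G : Set (Finset α)))
    {s : α} (hs : ({s} : Finset α) ∈ G) {n : α →₀ ℕ} (hn : n s = 0) :
    (Rt 3 F G).coeff (n + Finsupp.single s 2) + (Rt 3 F G).coeff n ≤ (Rt 3 F G).coeff (n + Finsupp.single s 1) := by
  rw [Rt_comm]
  exact coeff_Rt_three_loopPeel hG hF hs hn

end Summit.CriticalPhenomena.PercolationContinuityZ3.Theorems.SahiCTCForms
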